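import Mathlib.Probability.Independence.Integration
import Literature.Probability.Process.ItoCalculus
import Literature.Probability.Process.SimpleProcessAlgebra
import Literature.Probability.Process.ItoIntegralConstruction
import Literature.Probability.Process.DoobMaximalIneq
import Literature.Probability.RandomPlanarGeometry.LocalMartingaleProofs
import HarnessLib

/-!
# Itô calculus for Brownian motion: elementary integrals (isometry, martingale, u.c.p. bound)

This file proves (sorry-free) the named fact `Literature.Probability.Process.itoIsometry_simple` of
`Literature.Probability.Process.ItoCalculus` and the two companion facts about elementary
stochastic integrals `H · B` of bounded simple processes `H` (adapted to the raw Brownian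
filtration) against the canonical Brownian motion `B = Literature.brownian` under the pre-Wiener measure:

* `Literature.Probability.Process.itoIsometry_simple_holds` — **Itô isometry** `E[(H · B)ₜ²] = E[∫₀ᵗ H(s)² ds]`;
* `Literature.Probability.Process.martingale_integral_brownian` — `H · B` is a martingale for the raw Brownian filtration;
* `Literature.Probability.Process.measure_sup_integral_ge_le_brownian` — the **basic u.c.p. estimate**
  `P(sup_{s ≤ t} |(H · B)ₛ| ≥ ε) ≤ P(∫₀ᵗ H² ds > η) + η / ε²`.

The proofs are the textbook ones (Itô 1944; the elementary case of Revuz–Yor, Ch. IV,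
Thm (2.2), cf. the paragraph on the *elementary stochastic integral* after Def. (2.3), where
`K · M ∈ H₀²` "is easily seen"): write `(H · B)ₜ = ∑ᵢ Hᵢ ΔᵢB` with
`ΔᵢB = B_{t ∧ tᵢ₊₁} - B_{t ∧ tᵢ}`; cross terms `E[Hᵢ ΔᵢB Hⱼ ΔⱼB]`, `i < j`, vanish because `ΔⱼB`
is independent of `𝓕⁰_{tⱼ} ∋ Hᵢ ΔᵢB Hⱼ` and centred, and `E[Hᵢ² (ΔᵢB)²] = E[Hᵢ²] (t ∧ tᵢ₊₁ - t ∧ tᵢ)`;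
pathwise `∫₀ᵗ H² ds = ∑ᵢ Hᵢ² (t ∧ tᵢ₊₁ - t ∧ tᵢ)` (`SimpleProcess.setIntegral_toProcess_sq`). The
martingale property is `E[B_u | 𝓕⁰_s] = B_{s ∧ u}` summand by summand. The u.c.p. estimate
truncates `H` at level `η` of its partial time integrals (`SimpleProcess.truncate`, which keeps
the integrand elementary), and applies Doob's `L²` maximal inequality in continuous time
(`Literature.Probability.Process.doob_sq_maximal_ineq_of_continuous`) to the martingale `H^η · B`, whose second moment is
`E ∫₀ᵗ (H^η)² ≤ η` by the isometry. The probabilistic inputs are the increment facts of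
`LocalMartingaleProofs` (`indep_comap_brownian_sub_brownianFiltration`, `condExp_brownian_sub`,
`integral_brownian_sub_sq`, `martingale_brownian_holds`).

## References

* K. Itô, *Stochastic integral*, Proc. Imp. Acad. Tokyo 20 (1944), 519–524.
* D. Revuz, M. Yor, *Continuous Martingales and Brownian Motion* (3rd ed., 1999), Ch. IV, §2,
  Def. (2.1), Thm (2.2) (the map `K ↦ K · M` is an isometry from `L²(M)` into `H₀²`), Def. (2.3)
  and the paragraph following it (elementary processes `ℰ`, elementary stochastic integral),
  Prop. (2.5), Prop. (2.10)(ii), Thm (2.12) (convergence in probability, uniformly on compacts,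
  by stopping and Thm (2.2)).
-/

open MeasureTheory ProbabilityTheory Filter Finset
open scoped NNReal ENNReal Topology

noncomputable section

namespace Literature.Probability.Process

/-! ### Independence of increments from `𝓕⁰`-measurable random variables -/

/-- A random variable measurable for the Brownian filtration at time `u` is independent of any
later increment `B_v - B_u`, `u ≤ v`.
Revuz–Yor, *Continuous Martingales and Brownian Motion* (1999), Ch. III, Def. (2.20). [folklore] -/
theorem indepFun_of_measurable_brownianFiltration {u v : ℝ≥0} (huv : u ≤ v)
    {Y : (ℝ≥0 → ℝ) → ℝ} (hY : Measurable[RandomPlanarGeometry.brownianFiltration u] Y) :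
    IndepFun Y (brownian v - brownian u) preWienerMeasure := by
  rw [IndepFun_iff_Indep]
  exact (indep_of_indep_of_le_right (RandomPlanarGeometry.indep_comap_brownian_sub_brownianFiltration huv)
    (measurable_iff_comap_le.1 hY)).symm

/-- `E[B_u | 𝓕⁰_s] = B_{s ∧ u}`: the martingale property of `brownian` for `s ≤ u` and
measurability for `u ≤ s`.
Revuz–Yor, *Continuous Martingales and Brownian Motion* (1999), Ch. II, Prop. (1.2)(i).
[folklore] -/
theorem condExp_brownian_min (s u : ℝ≥0) :
    preWienerMeasure[brownian u | RandomPlanarGeometry.brownianFiltration s] =ᵐ[preWienerMeasure] brownian (min s u) := by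
  haveI := RandomPlanarGeometry.isProbabilityMeasure_preWienerMeasure'
  rcases le_total u s with hus | hsu
  · rw [min_eq_right hus, condExp_of_stronglyMeasurable (RandomPlanarGeometry.brownianFiltration.le s)
      ((RandomPlanarGeometry.stronglyAdapted_brownian u).mono (RandomPlanarGeometry.brownianFiltration.mono hus)) (RandomPlanarGeometry.integrable_brownian u)]
  · rw [min_eq_left hsu]
    exact RandomPlanarGeometry.martingale_brownian_holds.condExp_ae_eq hsu

section Elementary

variable (H : SimpleProcess (inferInstance : MeasurableSpace (ℝ≥0 → ℝ)) RandomPlanarGeometry.brownianFiltration)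

/-! ### Integrability and measurability of the summands `Hᵢ ΔᵢB` -/

/-- In range, the values of a simple process are a.e. strongly measurable. [folklore] -/
theorem aestronglyMeasurable_value_brownian {i : ℕ} (hi : i < H.times.length) :
    AEStronglyMeasurable (H.value i) preWienerMeasure :=
  (H.stronglyMeasurable_value' hi).aestronglyMeasurable

/-- A bounded adapted value times an `L²` random variable is `L²`. [folklore] -/
theorem memLp_two_value_mul_brownian {i : ℕ} (hi : i < H.times.length) {X : (ℝ≥0 → ℝ) → ℝ}
    (hX : MemLp X 2 preWienerMeasure) :
    MemLp (fun ω ↦ H.value i ω * X ω) 2 preWienerMeasure := by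
  obtain ⟨C, hC⟩ := H.bounded
  refine hX.of_le_mul (c := C) ((aestronglyMeasurable_value_brownian H hi).mul hX.1)
    (ae_of_all _ fun ω ↦ ?_)
  rw [norm_mul, Real.norm_eq_abs]
  exact mul_le_mul_of_nonneg_right (hC i ω) (norm_nonneg _)

/-- The summands `Hᵢ (B_{r ∧ tᵢ₊₁} - B_{r ∧ tᵢ})` of the elementary integral are in `L²`.
[folklore] -/
theorem memLp_two_summand_brownian {i : ℕ} (hi : i < H.times.length) (r : ℝ≥0) :
    MemLp (H.summand brownian i r) 2 preWienerMeasure :=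
  memLp_two_value_mul_brownian H hi (RandomPlanarGeometry.memLp_two_brownian_sub _ _)

/-- The summands of the elementary integral are integrable. [folklore] -/
theorem integrable_summand_brownian {i : ℕ} (hi : i < H.times.length) (r : ℝ≥0) :
    Integrable (H.summand brownian i r) preWienerMeasure :=
  haveI := RandomPlanarGeometry.isProbabilityMeasure_preWienerMeasure'
  (memLp_two_summand_brownian H hi r).integrable one_le_two

/-- The squared values of a simple process are integrable (bounded and measurable). [folklore] -/
theorem integrable_value_sq_brownian {i : ℕ} (hi : i < H.times.length) :
    Integrable (fun ω ↦ H.value i ω ^ 2) preWienerMeasure := by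
  haveI := RandomPlanarGeometry.isProbabilityMeasure_preWienerMeasure'
  have h : MemLp (fun ω ↦ H.value i ω * (1 : ℝ)) 2 preWienerMeasure :=
    memLp_two_value_mul_brownian H hi (memLp_const 1)
  simpa using h.integrable_sq

/-- Each summand of the elementary integral is `𝓕⁰_r`-strongly measurable at time `r`
(it vanishes identically for `r ≤ tᵢ`). [folklore] -/
theorem stronglyMeasurable_summand_brownian {i : ℕ} (hi : i + 1 < H.times.length) (r : ℝ≥0) :
    StronglyMeasurable[RandomPlanarGeometry.brownianFiltration r] (H.summand brownian i r) := by
  by_cases hr : r ≤ H.time i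
  · rw [H.summand_eq_zero_of_le brownian hi hr]
    exact stronglyMeasurable_zero
  · push Not at hr
    exact ((H.stronglyMeasurable_value (by omega)).mono (RandomPlanarGeometry.brownianFiltration.mono hr.le)).mul
      (((RandomPlanarGeometry.stronglyAdapted_brownian _).mono (RandomPlanarGeometry.brownianFiltration.mono (min_le_left _ _))).sub
        ((RandomPlanarGeometry.stronglyAdapted_brownian _).mono (RandomPlanarGeometry.brownianFiltration.mono (min_le_left _ _))))

/-- The summand `Hᵢ ΔᵢB` at horizon `t` is `𝓕⁰_u`-strongly measurable for every `u ≥ tᵢ₊₁`.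
[folklore] -/
theorem stronglyMeasurable_summand_of_le_brownian {i : ℕ} (hi : i + 1 < H.times.length) (t : ℝ≥0)
    {u : ℝ≥0} (hu : H.time (i + 1) ≤ u) :
    StronglyMeasurable[RandomPlanarGeometry.brownianFiltration u] (H.summand brownian i t) := by
  refine ((H.stronglyMeasurable_value (by omega)).mono
    (RandomPlanarGeometry.brownianFiltration.mono ((H.time_mono (Nat.le_succ i) hi).trans hu))).mul ?_
  exact ((RandomPlanarGeometry.stronglyAdapted_brownian _).mono (RandomPlanarGeometry.brownianFiltration.mono
      ((min_le_right _ _).trans hu))).sub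
    ((RandomPlanarGeometry.stronglyAdapted_brownian _).mono (RandomPlanarGeometry.brownianFiltration.mono ((min_le_right _ _).trans
      ((H.time_mono (Nat.le_succ i) hi).trans hu))))

/-! ### The Itô isometry for simple integrands -/

/-- **Cross terms vanish**: `E[Hᵢ ΔᵢB · Hⱼ ΔⱼB] = 0` for `i < j`: `Y = Hᵢ ΔᵢB Hⱼ` is
`𝓕⁰_{tⱼ}`-measurable and `ΔⱼB = B_{t ∧ tⱼ₊₁} - B_{tⱼ}` is independent of it and centred.
Revuz–Yor, *Continuous Martingales and Brownian Motion* (1999), Ch. IV, Thm (2.2) and the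
elementary stochastic integral after Def. (2.3). [folklore] -/
theorem integral_summand_mul_summand_eq_zero_brownian {i j : ℕ} (hij : i < j)
    (hj : j + 1 < H.times.length) (t : ℝ≥0) :
    ∫ ω, H.summand brownian i t ω * H.summand brownian j t ω ∂preWienerMeasure = 0 := by
  have hi : i + 1 < H.times.length := by omega
  by_cases htj : t ≤ H.time j
  · simp [H.summand_eq_zero_of_le brownian hj htj]
  push Not at htj
  set v : ℝ≥0 := min t (H.time (j + 1)) with hv
  have hjv : H.time j ≤ v := le_min htj.le (H.time_mono (Nat.le_succ j) hj)
  have hY : StronglyMeasurable[RandomPlanarGeometry.brownianFiltration (H.time j)]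
      (fun ω ↦ H.summand brownian i t ω * H.value j ω) :=
    (stronglyMeasurable_summand_of_le_brownian H hi t (H.time_mono (Nat.succ_le_of_lt hij) (by omega))).mul
      (H.stronglyMeasurable_value (by omega))
  have hind := indepFun_of_measurable_brownianFiltration hjv hY.measurable
  have hcalc : (fun ω ↦ H.summand brownian i t ω * H.summand brownian j t ω) =
      fun ω ↦ (H.summand brownian i t ω * H.value j ω) *
        (brownian v - brownian (H.time j)) ω := by
    ext ω
    rw [H.summand_eq_of_lt brownian htj]
    simp only [Pi.mul_apply, Pi.sub_apply]
    ring
  rw [hcalc, hind.integral_fun_mul_eq_mul_integral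
      (hY.mono (RandomPlanarGeometry.brownianFiltration.le _)).aestronglyMeasurable (RandomPlanarGeometry.memLp_two_brownian_sub _ _).1,
    RandomPlanarGeometry.integral_brownian_sub, mul_zero]

/-- **Diagonal terms**: `E[Hᵢ² (ΔᵢB)²] = E[Hᵢ²] (t ∧ tᵢ₊₁ - t ∧ tᵢ)`.
Revuz–Yor, *Continuous Martingales and Brownian Motion* (1999), Ch. IV, Thm (2.2) and the
elementary stochastic integral after Def. (2.3). [folklore] -/
theorem integral_summand_sq_brownian {i : ℕ} (hi : i + 1 < H.times.length) (t : ℝ≥0) :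
    ∫ ω, (H.summand brownian i t ω) ^ 2 ∂preWienerMeasure =
      (∫ ω, H.value i ω ^ 2 ∂preWienerMeasure) *
        ((min t (H.time (i + 1)) : ℝ≥0) - (min t (H.time i) : ℝ≥0) : ℝ) := by
  by_cases hti : t ≤ H.time i
  · have h1 : min t (H.time (i + 1)) = t :=
      min_eq_left (hti.trans (H.time_mono (Nat.le_succ i) hi))
    have h2 : min t (H.time i) = t := min_eq_left hti
    simp [H.summand_eq_zero_of_le brownian hi hti, h1, h2]
  push Not at hti
  set v : ℝ≥0 := min t (H.time (i + 1)) with hv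
  have hiv : H.time i ≤ v := le_min hti.le (H.time_mono (Nat.le_succ i) hi)
  have hY : StronglyMeasurable[RandomPlanarGeometry.brownianFiltration (H.time i)] (fun ω ↦ H.value i ω ^ 2) :=
    (H.stronglyMeasurable_value (by omega)).pow 2
  have hind : IndepFun (fun ω ↦ H.value i ω ^ 2)
      (fun ω ↦ (brownian v - brownian (H.time i)) ω ^ 2) preWienerMeasure := by
    have := (indepFun_of_measurable_brownianFiltration hiv hY.measurable).comp
      measurable_id (measurable_id.pow_const 2)
    simpa [Function.comp_def] using this
  have hcalc : (fun ω ↦ (H.summand brownian i t ω) ^ 2) =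
      fun ω ↦ H.value i ω ^ 2 * (brownian v - brownian (H.time i)) ω ^ 2 := by
    ext ω
    rw [H.summand_eq_of_lt brownian hti]
    simp only [Pi.mul_apply, Pi.sub_apply]
    ring
  have hae : AEStronglyMeasurable (fun ω ↦ (brownian v - brownian (H.time i)) ω ^ 2)
      preWienerMeasure :=
    (continuous_pow 2).comp_aestronglyMeasurable (RandomPlanarGeometry.memLp_two_brownian_sub _ _).1
  rw [hcalc, hind.integral_fun_mul_eq_mul_integral
      (hY.mono (RandomPlanarGeometry.brownianFiltration.le _)).aestronglyMeasurable hae,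
    RandomPlanarGeometry.integral_brownian_sub_sq hiv, min_eq_right hti.le]

/-- **Second moment of the elementary integral**:
`E[(H · B)ₜ²] = ∑ᵢ E[Hᵢ²] (t ∧ tᵢ₊₁ - t ∧ tᵢ)`.
Revuz–Yor, *Continuous Martingales and Brownian Motion* (1999), Ch. IV, Thm (2.2) and the
elementary stochastic integral after Def. (2.3). [folklore] -/
theorem integral_integral_sq_brownian (t : ℝ≥0) :
    ∫ ω, (H.integral brownian t ω) ^ 2 ∂preWienerMeasure =
      ∑ i ∈ range (H.times.length - 1), (∫ ω, H.value i ω ^ 2 ∂preWienerMeasure) *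
        ((min t (H.time (i + 1)) : ℝ≥0) - (min t (H.time i) : ℝ≥0) : ℝ) := by
  have hint : ∀ i ∈ range (H.times.length - 1), ∀ j ∈ range (H.times.length - 1),
      Integrable (fun ω ↦ H.summand brownian i t ω * H.summand brownian j t ω)
        preWienerMeasure := fun i hi j hj ↦
    (memLp_two_summand_brownian H (by have := mem_range.1 hi; omega) t).integrable_mul
      (memLp_two_summand_brownian H (by have := mem_range.1 hj; omega) t)
  calc ∫ ω, (H.integral brownian t ω) ^ 2 ∂preWienerMeasure
      = ∫ ω, ∑ i ∈ range (H.times.length - 1), ∑ j ∈ range (H.times.length - 1),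
          H.summand brownian i t ω * H.summand brownian j t ω ∂preWienerMeasure := by
        refine integral_congr_ae (ae_of_all _ fun ω ↦ ?_)
        simp only [H.integral_apply_eq_sum_summand, sq, sum_mul_sum]
    _ = ∑ i ∈ range (H.times.length - 1), ∑ j ∈ range (H.times.length - 1),
          ∫ ω, H.summand brownian i t ω * H.summand brownian j t ω ∂preWienerMeasure := by
        rw [integral_finsetSum _ fun i hi ↦ integrable_finsetSum _ (hint i hi)]
        exact sum_congr rfl fun i hi ↦ integral_finsetSum _ (hint i hi)
    _ = ∑ i ∈ range (H.times.length - 1),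
          ∫ ω, (H.summand brownian i t ω) ^ 2 ∂preWienerMeasure := by
        refine sum_congr rfl fun i hi ↦ ?_
        rw [sum_eq_single i (fun j hj hji ↦ ?_) (fun h ↦ (h hi).elim)]
        · simp only [sq]
        · rcases lt_or_gt_of_ne hji with h | h
          · rw [integral_congr_ae (ae_of_all _ fun ω ↦ mul_comm _ _)]
            exact integral_summand_mul_summand_eq_zero_brownian H h (by have := mem_range.1 hi; omega) t
          · exact integral_summand_mul_summand_eq_zero_brownian H h (by have := mem_range.1 hj; omega) t
    _ = _ := sum_congr rfl fun i hi ↦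
        integral_summand_sq_brownian H (by have := mem_range.1 hi; omega) t

/-! ### The elementary integral is a martingale -/

/-- **Martingale property of one summand**: `E[aᵢ(t) | 𝓕⁰_s] = aᵢ(s)` for `s ≤ t`, where
`aᵢ(r) = Hᵢ (B_{r ∧ tᵢ₊₁} - B_{r ∧ tᵢ})`.
Revuz–Yor, *Continuous Martingales and Brownian Motion* (1999), Ch. IV, §2, elementary
stochastic integral after Def. (2.3) ("it is easily seen that `K · M ∈ H₀²`"). [folklore] -/
theorem condExp_summand_brownian {i : ℕ} (hi : i + 1 < H.times.length) {s t : ℝ≥0} (hst : s ≤ t) :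
    preWienerMeasure[H.summand brownian i t | RandomPlanarGeometry.brownianFiltration s] =ᵐ[preWienerMeasure]
      H.summand brownian i s := by
  haveI := RandomPlanarGeometry.isProbabilityMeasure_preWienerMeasure'
  by_cases hsi : H.time i < s
  · -- `Hᵢ` is `𝓕⁰_s`-measurable: pull it out and use `E[B_u | 𝓕⁰_s] = B_{s ∧ u}`
    have hHi : StronglyMeasurable[RandomPlanarGeometry.brownianFiltration s] (H.value i) :=
      (H.stronglyMeasurable_value (by omega)).mono (RandomPlanarGeometry.brownianFiltration.mono hsi.le)
    have hΔ : Integrable (brownian (min t (H.time (i + 1))) - brownian (min t (H.time i)))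
        preWienerMeasure := (RandomPlanarGeometry.integrable_brownian _).sub (RandomPlanarGeometry.integrable_brownian _)
    have hfun : H.summand brownian i t =
        H.value i * (brownian (min t (H.time (i + 1))) - brownian (min t (H.time i))) := by
      ext ω; simp [SimpleProcess.summand]
    have hint : Integrable
        (H.value i * (brownian (min t (H.time (i + 1))) - brownian (min t (H.time i))))
        preWienerMeasure := by
      rw [← hfun]; exact integrable_summand_brownian H (i := i) (by omega) t
    have h1 := condExp_mul_of_stronglyMeasurable_left hHi hint hΔ
      (μ := preWienerMeasure) (m := RandomPlanarGeometry.brownianFiltration s)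
    have h2 := condExp_sub (RandomPlanarGeometry.integrable_brownian (min t (H.time (i + 1))))
      (RandomPlanarGeometry.integrable_brownian (min t (H.time i))) (RandomPlanarGeometry.brownianFiltration s) (μ := preWienerMeasure)
    have h3 := condExp_brownian_min s (min t (H.time (i + 1)))
    have h4 := condExp_brownian_min s (min t (H.time i))
    have hmin1 : min s (min t (H.time (i + 1))) = min s (H.time (i + 1)) := by
      rw [← min_assoc, min_eq_left hst]
    have hmin2 : min s (min t (H.time i)) = min s (H.time i) := by
      rw [← min_assoc, min_eq_left hst]
    rw [hfun]
    filter_upwards [h1, h2, h3, h4] with ω h1ω h2ω h3ω h4ω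
    rw [h1ω, Pi.mul_apply, h2ω, Pi.sub_apply, h3ω, h4ω, hmin1, hmin2]
    simp [SimpleProcess.summand]
  · -- `s ≤ tᵢ`: the summand vanishes at `s`, and `E[aᵢ(t) | 𝓕⁰_{tᵢ}] = 0` by centring
    push Not at hsi
    rw [H.summand_eq_zero_of_le brownian hi hsi]
    by_cases hti : t ≤ H.time i
    · rw [H.summand_eq_zero_of_le brownian hi hti, condExp_zero]
    push Not at hti
    have htow := condExp_condExp_of_le (RandomPlanarGeometry.brownianFiltration.mono hsi)
      (RandomPlanarGeometry.brownianFiltration.le (H.time i)) (μ := preWienerMeasure) (f := H.summand brownian i t)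
    have hHi : StronglyMeasurable[RandomPlanarGeometry.brownianFiltration (H.time i)] (H.value i) :=
      H.stronglyMeasurable_value (by omega)
    have hiv : H.time i ≤ min t (H.time (i + 1)) :=
      le_min hti.le (H.time_mono (Nat.le_succ i) hi)
    have hfun := H.summand_eq_of_lt brownian hti (i := i)
    have hΔ : Integrable (brownian (min t (H.time (i + 1))) - brownian (H.time i))
        preWienerMeasure := (RandomPlanarGeometry.integrable_brownian _).sub (RandomPlanarGeometry.integrable_brownian _)
    have hint : Integrable
        (H.value i * (brownian (min t (H.time (i + 1))) - brownian (H.time i)))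
        preWienerMeasure := by
      rw [← hfun]; exact integrable_summand_brownian H (i := i) (by omega) t
    have h1 := condExp_mul_of_stronglyMeasurable_left hHi hint hΔ
      (μ := preWienerMeasure) (m := RandomPlanarGeometry.brownianFiltration (H.time i))
    have h2 := RandomPlanarGeometry.condExp_brownian_sub hiv
    have hinner : preWienerMeasure[H.summand brownian i t | RandomPlanarGeometry.brownianFiltration (H.time i)]
        =ᵐ[preWienerMeasure] 0 := by
      rw [hfun]
      filter_upwards [h1, h2] with ω h1ω h2ω
      rw [h1ω, Pi.mul_apply, h2ω]
      simp
    refine htow.symm.trans ((condExp_congr_ae hinner).trans ?_)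
    rw [condExp_zero]

/-- **The elementary stochastic integral of a bounded simple process against the canonical
Brownian motion is a martingale** for the raw Brownian filtration under the pre-Wiener measure.
Revuz–Yor, *Continuous Martingales and Brownian Motion* (1999), Ch. IV, §2, elementary
stochastic integral after Def. (2.3) (`K · M ∈ H₀²`). [folklore] -/
theorem martingale_integral_brownian :
    Martingale (H.integral brownian) RandomPlanarGeometry.brownianFiltration preWienerMeasure := by
  refine ⟨fun r ↦ ?_, fun s t hst ↦ ?_⟩
  · rw [H.integral_eq_sum_summand]
    exact Finset.stronglyMeasurable_sum _ fun i hi ↦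
      stronglyMeasurable_summand_brownian H (by have := mem_range.1 hi; omega) r
  · rw [H.integral_eq_sum_summand, H.integral_eq_sum_summand]
    have hsum := condExp_finsetSum (fun i hi ↦ integrable_summand_brownian H
      (by have := mem_range.1 hi; omega) t) (RandomPlanarGeometry.brownianFiltration s) (μ := preWienerMeasure)
      (s := range (H.times.length - 1)) (f := fun i ↦ H.summand brownian i t)
    have hall : ∀ᵐ ω ∂preWienerMeasure, ∀ i ∈ range (H.times.length - 1),
        (preWienerMeasure[H.summand brownian i t | RandomPlanarGeometry.brownianFiltration s]) ω =
          H.summand brownian i s ω :=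
      (eventually_all_finset _).2 fun i hi ↦
        condExp_summand_brownian H (by have := mem_range.1 hi; omega) hst
    filter_upwards [hsum, hall] with ω h1 h2
    rw [h1, Finset.sum_apply, Finset.sum_apply]
    exact Finset.sum_congr rfl h2

/-- Elementary integrals against the canonical Brownian motion are square integrable.
[folklore] -/
theorem memLp_two_integral_brownian (r : ℝ≥0) : MemLp (H.integral brownian r) 2 preWienerMeasure := by
  rw [H.integral_eq_sum_summand]
  exact memLp_finsetSum' _ fun i hi ↦
    memLp_two_summand_brownian H (by have := mem_range.1 hi; omega) r

end Elementary

/-! ### The Itô isometry and the basic u.c.p. estimate -/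

/-- **Itô isometry for simple integrands** (discharge of the named fact `Literature.Probability.Process.itoIsometry_simple`):
for a bounded simple process `H` adapted to the raw Brownian filtration,
`E[(H · B)ₜ²] = E[∫₀ᵗ H(s)² ds]` under the pre-Wiener measure. Both sides equal
`∑ᵢ E[Hᵢ²] (t ∧ tᵢ₊₁ - t ∧ tᵢ)` (`integral_integral_sq_brownian`, `SimpleProcess.setIntegral_toProcess_sq`).
Itô (1944); Revuz–Yor, *Continuous Martingales and Brownian Motion* (1999), Ch. IV, §2,
Thm (2.2) (isometry `L²(M) → H₀²`) and the elementary stochastic integral after Def. (2.3).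
[cite: RevuzYor1999, Ch. IV Thm (2.2)] -/
theorem itoIsometry_simple_holds : itoIsometry_simple := by
  intro H t
  rw [integral_integral_sq_brownian]
  simp_rw [SimpleProcess.setIntegral_toProcess_sq]
  rw [integral_finsetSum]
  · refine sum_congr rfl fun i hi ↦ ?_
    rw [integral_mul_const]
  · intro i hi
    exact (integrable_value_sq_brownian H (by have := mem_range.1 hi; omega)).mul_const _

/-- **The basic estimate for elementary Itô integrals** (Lenglart-type inequality): for a bounded
simple process `H` adapted to the raw Brownian filtration and `ε, η > 0`,
`P(sup_{s ≤ t} |(H · B)ₛ| ≥ ε) ≤ P(∫₀ᵗ H² ds > η) + η / ε²`.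
Proof: on `{∫₀ᵗ H² ds ≤ η}` the elementary integrals of `H` and of its truncation `H^η`
(`SimpleProcess.truncate`) agree; `H^η · B` is a square-integrable martingale with continuous
paths and `E[(H^η · B)ₜ²] = E[∫₀ᵗ (H^η)² ds] ≤ η` (Itô isometry), so Doob's `L²` maximal
inequality bounds the second event.
Revuz–Yor, *Continuous Martingales and Brownian Motion* (1999), Ch. IV, Thm (2.12) (dominated
convergence for stochastic integrals, in probability uniformly on compacts, via stopping and
Thm (2.2)) and Prop. (2.10)(ii)/(2.5) (`(K 1_{[0,T]}) · X = (K · X)^T`); here the stopping is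
done at partition times, which keeps the integrand elementary. [folklore] -/
theorem measure_sup_integral_ge_le_brownian
    (H : SimpleProcess (inferInstance : MeasurableSpace (ℝ≥0 → ℝ)) RandomPlanarGeometry.brownianFiltration)
    {ε η : ℝ} (hε : 0 < ε) (hη : 0 < η) (t : ℝ≥0) :
    preWienerMeasure {ω | ∃ s ≤ t, ε ≤ |H.integral brownian s ω|} ≤
      preWienerMeasure {ω | η < ∫ s in Set.Icc (0 : ℝ) t, (H.toProcess s.toNNReal ω) ^ 2} +
        ENNReal.ofReal (η / ε ^ 2) := by
  haveI := RandomPlanarGeometry.isProbabilityMeasure_preWienerMeasure'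
  set H' := H.truncate t η with hH'
  -- split according to `{∫₀ᵗ H² ds ≤ η}`
  have hsub : {ω | ∃ s ≤ t, ε ≤ |H.integral brownian s ω|} ⊆
      {ω | η < ∫ s in Set.Icc (0 : ℝ) t, (H.toProcess s.toNNReal ω) ^ 2} ∪
        {ω | ∃ s ≤ t, ε ≤ |H'.integral brownian s ω|} := by
    rintro ω ⟨s, hs, hεs⟩
    by_cases hω : ∫ s in Set.Icc (0 : ℝ) t, (H.toProcess s.toNNReal ω) ^ 2 ≤ η
    · refine Or.inr ⟨s, hs, ?_⟩
      rwa [hH', H.integral_truncate_eq t η brownian hω]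
    · exact Or.inl (not_le.1 hω)
  refine (measure_mono hsub).trans ((measure_union_le _ _).trans ?_)
  gcongr
  -- Doob for the martingale `H' · B`
  have hD := doob_sq_maximal_ineq_of_continuous (martingale_integral_brownian H') (memLp_two_integral_brownian H')
    (ae_of_all _ fun ω ↦ H'.continuous_integral (continuous_brownian ω)) hε t
    (μ := preWienerMeasure)
  refine hD.trans (ENNReal.ofReal_le_ofReal (div_le_div_of_nonneg_right ?_ (sq_nonneg ε)))
  -- `E[(H' · B)ₜ²] = E[∫₀ᵗ H'² ds] ≤ η`
  rw [itoIsometry_simple_holds H' t]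
  calc ∫ ω, (∫ s in Set.Icc (0 : ℝ) t, (H'.toProcess s.toNNReal ω) ^ 2) ∂preWienerMeasure
      ≤ ∫ _, η ∂preWienerMeasure :=
        integral_mono_of_nonneg (ae_of_all _ fun ω ↦ integral_nonneg fun s ↦ sq_nonneg _)
          (integrable_const η)
          (ae_of_all _ fun ω ↦ H.setIntegral_toProcess_truncate_sq_le t hη.le ω)
    _ = η := by simp

/-! ### Consequences: differences of elementary integrals and the `∀ approximating sequence` clause -/

/-- `ofReal ((x - y)²) ≤ 2 ofReal (x²) + 2 ofReal (y²)` in `ℝ≥0∞`. [folklore] -/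
theorem ofReal_sub_sq_le (x y : ℝ) :
    ENNReal.ofReal ((x - y) ^ 2) ≤ 2 * ENNReal.ofReal (x ^ 2) + 2 * ENNReal.ofReal (y ^ 2) := by
  have h : (x - y) ^ 2 ≤ 2 * x ^ 2 + 2 * y ^ 2 := by nlinarith [sq_nonneg (x + y)]
  calc ENNReal.ofReal ((x - y) ^ 2) ≤ ENNReal.ofReal (2 * x ^ 2 + 2 * y ^ 2) :=
        ENNReal.ofReal_le_ofReal h
    _ = 2 * ENNReal.ofReal (x ^ 2) + 2 * ENNReal.ofReal (y ^ 2) := by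
        rw [ENNReal.ofReal_add (by positivity) (by positivity), ENNReal.ofReal_mul zero_le_two,
          ENNReal.ofReal_mul zero_le_two, ENNReal.ofReal_ofNat]

/-- **Time integral of a difference of simple processes against a common target**: if both
`∫₀ᵗ (H - σ)²` and `∫₀ᵗ (K - σ)²` are `< η / 4` (as extended integrals) and `s ↦ σ(s⁺, ω)` is
measurable, then `∫₀ᵗ (H - K)² ≤ η` (real integral of the step process `H - K`). [folklore] -/
theorem setIntegral_toProcess_sub_sq_le
    (H K : SimpleProcess (inferInstance : MeasurableSpace (ℝ≥0 → ℝ)) RandomPlanarGeometry.brownianFiltration)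
    {σ : ℝ≥0 → (ℝ≥0 → ℝ) → ℝ} {ω : ℝ≥0 → ℝ} (hσ : Measurable fun s : ℝ ↦ σ s.toNNReal ω)
    {η : ℝ} (hη : 0 ≤ η) (t : ℝ≥0)
    (hH : ∫⁻ s in Set.Icc (0 : ℝ) t,
      ENNReal.ofReal ((H.toProcess s.toNNReal ω - σ s.toNNReal ω) ^ 2) < ENNReal.ofReal (η / 4))
    (hK : ∫⁻ s in Set.Icc (0 : ℝ) t,
      ENNReal.ofReal ((K.toProcess s.toNNReal ω - σ s.toNNReal ω) ^ 2) < ENNReal.ofReal (η / 4)) :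
    ∫ s in Set.Icc (0 : ℝ) t, ((H.sub K).toProcess s.toNNReal ω) ^ 2 ≤ η := by
  have hmeas : Measurable fun s : ℝ ↦ ((H.sub K).toProcess s.toNNReal ω) ^ 2 :=
    ((H.sub K).measurable_toProcess_prod.comp measurable_prodMk_left).pow_const 2
  rw [integral_eq_lintegral_of_nonneg_ae (ae_of_all _ fun s ↦ sq_nonneg _)
    hmeas.aestronglyMeasurable]
  refine ENNReal.toReal_le_of_le_ofReal hη ?_
  have hHm : Measurable fun s : ℝ ↦
      ENNReal.ofReal ((H.toProcess s.toNNReal ω - σ s.toNNReal ω) ^ 2) :=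
    (((H.measurable_toProcess_prod.comp measurable_prodMk_left).sub hσ).pow_const 2).ennreal_ofReal
  calc ∫⁻ s in Set.Icc (0 : ℝ) t, ENNReal.ofReal (((H.sub K).toProcess s.toNNReal ω) ^ 2)
      ≤ ∫⁻ s in Set.Icc (0 : ℝ) t,
          (2 * ENNReal.ofReal ((H.toProcess s.toNNReal ω - σ s.toNNReal ω) ^ 2) +
            2 * ENNReal.ofReal ((K.toProcess s.toNNReal ω - σ s.toNNReal ω) ^ 2)) := by
        refine lintegral_mono fun s ↦ ?_
        rw [H.toProcess_sub K]
        have := ofReal_sub_sq_le (H.toProcess s.toNNReal ω - σ s.toNNReal ω)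
          (K.toProcess s.toNNReal ω - σ s.toNNReal ω)
        rwa [sub_sub_sub_cancel_right] at this
    _ = 2 * (∫⁻ s in Set.Icc (0 : ℝ) t,
            ENNReal.ofReal ((H.toProcess s.toNNReal ω - σ s.toNNReal ω) ^ 2)) +
          2 * (∫⁻ s in Set.Icc (0 : ℝ) t,
            ENNReal.ofReal ((K.toProcess s.toNNReal ω - σ s.toNNReal ω) ^ 2)) := by
        rw [lintegral_add_left (hHm.const_mul 2), lintegral_const_mul _ hHm,
          lintegral_const_mul'' _ ?_]
        exact ((((K.measurable_toProcess_prod.comp measurable_prodMk_left).sub hσ).pow_const 2).ennreal_ofReal).aemeasurable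
    _ ≤ 2 * ENNReal.ofReal (η / 4) + 2 * ENNReal.ofReal (η / 4) :=
        add_le_add (mul_le_mul_right hH.le _) (mul_le_mul_right hK.le _)
    _ = ENNReal.ofReal η := by
        rw [← two_mul, ← mul_assoc, ← ENNReal.ofReal_ofNat 2, ← ENNReal.ofReal_mul zero_le_two,
          ← ENNReal.ofReal_mul (by positivity)]
        congr 1
        ring

/-- **Differences of elementary integrals are small in probability when both integrands are
close to a common target**: for bounded simple `H, K`, a target integrand `σ` with a.s.
time-measurable paths, and `ε, η > 0`,
`P(sup_{s ≤ t} |(H·B)ₛ - (K·B)ₛ| ≥ ε) ≤ P(∫₀ᵗ(H-σ)² ≥ η/4) + P(∫₀ᵗ(K-σ)² ≥ η/4) + η/ε²`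
(the basic estimate `measure_sup_integral_ge_le_brownian` applied to the simple process `H - K`).
Revuz–Yor, *Continuous Martingales and Brownian Motion* (1999), Ch. IV, Thm (2.12). [folklore] -/
theorem measure_sup_integral_sub_ge_le_brownian
    (H K : SimpleProcess (inferInstance : MeasurableSpace (ℝ≥0 → ℝ)) RandomPlanarGeometry.brownianFiltration)
    {σ : ℝ≥0 → (ℝ≥0 → ℝ) → ℝ}
    (hσ : ∀ᵐ ω ∂preWienerMeasure, Measurable fun s : ℝ ↦ σ s.toNNReal ω)
    {ε η : ℝ} (hε : 0 < ε) (hη : 0 < η) (t : ℝ≥0) :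
    preWienerMeasure {ω | ∃ s ≤ t, ε ≤ |H.integral brownian s ω - K.integral brownian s ω|} ≤
      preWienerMeasure {ω | ENNReal.ofReal (η / 4) ≤ ∫⁻ s in Set.Icc (0 : ℝ) t,
          ENNReal.ofReal ((H.toProcess s.toNNReal ω - σ s.toNNReal ω) ^ 2)} +
        preWienerMeasure {ω | ENNReal.ofReal (η / 4) ≤ ∫⁻ s in Set.Icc (0 : ℝ) t,
          ENNReal.ofReal ((K.toProcess s.toNNReal ω - σ s.toNNReal ω) ^ 2)} +
        ENNReal.ofReal (η / ε ^ 2) := by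
  have h1 := measure_sup_integral_ge_le_brownian (H.sub K) hε hη t
  have heq : {ω | ∃ s ≤ t, ε ≤ |H.integral brownian s ω - K.integral brownian s ω|} =
      {ω | ∃ s ≤ t, ε ≤ |(H.sub K).integral brownian s ω|} := by
    ext ω; simp only [Set.mem_setOf_eq, H.integral_sub K]
  rw [heq]
  refine h1.trans ?_
  gcongr ?_ + _
  -- the bad event for `H - K` is covered by the two bad events and the null set
  have hsub : {ω | η < ∫ s in Set.Icc (0 : ℝ) t, ((H.sub K).toProcess s.toNNReal ω) ^ 2} ⊆
      {ω | ENNReal.ofReal (η / 4) ≤ ∫⁻ s in Set.Icc (0 : ℝ) t,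
          ENNReal.ofReal ((H.toProcess s.toNNReal ω - σ s.toNNReal ω) ^ 2)} ∪
        {ω | ENNReal.ofReal (η / 4) ≤ ∫⁻ s in Set.Icc (0 : ℝ) t,
          ENNReal.ofReal ((K.toProcess s.toNNReal ω - σ s.toNNReal ω) ^ 2)} ∪
        {ω | ¬ Measurable fun s : ℝ ↦ σ s.toNNReal ω} := by
    intro ω hω
    by_contra hcon
    simp only [Set.mem_union, Set.mem_setOf_eq, not_or, not_le, not_not] at hcon
    obtain ⟨⟨hH, hK⟩, hm⟩ := hcon
    exact absurd (setIntegral_toProcess_sub_sq_le H K hm hη.le t hH hK) (not_le.2 hω)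
  calc preWienerMeasure {ω | η < ∫ s in Set.Icc (0 : ℝ) t, ((H.sub K).toProcess s.toNNReal ω) ^ 2}
      ≤ _ := measure_mono hsub
    _ ≤ _ := measure_union_le _ _
    _ ≤ _ := by
        rw [show preWienerMeasure {ω | ¬ Measurable fun s : ℝ ↦ σ s.toNNReal ω} = 0 from
          ae_iff.1 hσ, add_zero]
        exact measure_union_le _ _

/-- **The `∀ approximating sequence` clause of `IsItoIntegral`**: if the elementary integrals
along ONE approximating sequence `Ln` of `σ` (in `L²_loc(ds)` in probability) converge to `J`
uniformly on compacts in probability, then so do the elementary integrals along EVERY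
approximating sequence `Hn` of `σ` (for `σ` with a.s. time-measurable paths).
Revuz–Yor, *Continuous Martingales and Brownian Motion* (1999), Ch. IV, Thm (2.12) and
Prop. (2.13). [folklore] -/
theorem tendstoUCP_of_isApproxSeq_brownian
    {Ln Hn : ℕ → SimpleProcess (inferInstance : MeasurableSpace (ℝ≥0 → ℝ)) RandomPlanarGeometry.brownianFiltration}
    {σ J : ℝ≥0 → (ℝ≥0 → ℝ) → ℝ}
    (hσ : ∀ᵐ ω ∂preWienerMeasure, Measurable fun s : ℝ ↦ σ s.toNNReal ω)
    (hL : SimpleProcess.IsApproxSeq Ln σ preWienerMeasure)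
    (hH : SimpleProcess.IsApproxSeq Hn σ preWienerMeasure)
    (hJ : TendstoUCP (fun n ↦ (Ln n).integral brownian) J preWienerMeasure) :
    TendstoUCP (fun n ↦ (Hn n).integral brownian) J preWienerMeasure := by
  haveI := RandomPlanarGeometry.isProbabilityMeasure_preWienerMeasure'
  intro t ε hε
  rw [ENNReal.tendsto_nhds_zero]
  intro δ hδ
  -- split `δ` into four quarters
  set δ4 : ℝ≥0∞ := δ / 2 / 2 with hδ4
  have hδ4pos : 0 < δ4 :=
    ENNReal.div_pos (ENNReal.div_pos hδ.ne' ENNReal.ofNat_ne_top).ne' ENNReal.ofNat_ne_top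
  -- choose the level `η` with `η / (ε/2)² ≤ δ/4`
  obtain ⟨η, hη, hηδ⟩ : ∃ η : ℝ, 0 < η ∧ ENNReal.ofReal (η / (ε / 2) ^ 2) ≤ δ4 := by
    by_cases htop : δ4 = ⊤
    · exact ⟨1, one_pos, htop ▸ le_top⟩
    · refine ⟨δ4.toReal * (ε / 2) ^ 2, ?_, ?_⟩
      · have : 0 < δ4.toReal := ENNReal.toReal_pos hδ4pos.ne' htop
        positivity
      · rw [mul_div_assoc, div_self (by positivity), mul_one, ENNReal.ofReal_toReal htop]
  have hε2 : 0 < ε / 2 := by positivity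
  have hA := hH t (η / 4) (by positivity)
  have hB := hL t (η / 4) (by positivity)
  have hC := hJ t (ε / 2) hε2
  rw [ENNReal.tendsto_nhds_zero] at hA hB hC
  filter_upwards [hA δ4 hδ4pos, hB δ4 hδ4pos, hC δ4 hδ4pos] with n hAn hBn hCn
  -- triangle inequality on the events
  have hsub : {ω | ∃ s ≤ t, ε ≤ |(Hn n).integral brownian s ω - J s ω|} ⊆
      {ω | ∃ s ≤ t, ε / 2 ≤ |(Hn n).integral brownian s ω - (Ln n).integral brownian s ω|} ∪
        {ω | ∃ s ≤ t, ε / 2 ≤ |(Ln n).integral brownian s ω - J s ω|} := by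
    rintro ω ⟨s, hs, hεs⟩
    by_contra hcon
    simp only [Set.mem_union, Set.mem_setOf_eq, not_or, not_exists, not_and, not_le] at hcon
    have h1 := hcon.1 s hs
    have h2 := hcon.2 s hs
    have : |(Hn n).integral brownian s ω - J s ω| ≤
        |(Hn n).integral brownian s ω - (Ln n).integral brownian s ω| +
          |(Ln n).integral brownian s ω - J s ω| := abs_sub_le _ _ _
    linarith
  calc preWienerMeasure {ω | ∃ s ≤ t, ε ≤ |(Hn n).integral brownian s ω - J s ω|}
      ≤ preWienerMeasure {ω | ∃ s ≤ t, ε / 2 ≤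
            |(Hn n).integral brownian s ω - (Ln n).integral brownian s ω|} +
          preWienerMeasure {ω | ∃ s ≤ t, ε / 2 ≤ |(Ln n).integral brownian s ω - J s ω|} :=
        (measure_mono hsub).trans (measure_union_le _ _)
    _ ≤ (δ4 + δ4 + δ4) + δ4 :=
        add_le_add ((measure_sup_integral_sub_ge_le_brownian (Hn n) (Ln n) hσ hε2 hη t).trans
          (add_le_add (add_le_add hAn hBn) hηδ)) hCn
    _ = δ := by
        have h2 : δ4 + δ4 = δ / 2 := ENNReal.add_halves (δ / 2)
        calc δ4 + δ4 + δ4 + δ4 = (δ4 + δ4) + (δ4 + δ4) := by ring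
          _ = δ / 2 + δ / 2 := by rw [h2]
          _ = δ := ENNReal.add_halves δ

end Literature.Probability.Process
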